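/-
PORT (pub-hodgecm2, COR-CM cell) of the stage-1 package file `HodgeCMPerL/HodgeCM/Proofs/Prop22/Dictionary.lean`
(pub-hodgecm HOME/lean, bytes of record md5 6ca8daf00e10, 173 lines). Declarations VERBATIM; edits: imports rewritten to tree
modules, namespace token `HodgeCM` ↦ `Summit.HodgeConjecture.CorCM`, package `conjRingHomK` ↦ tree `Literature.NumberTheory.Automorphic.cmConjRingHom`
(definitionally equal bodies), linter fixes. Generator: pub-hodgecm2-p1 `work/port/build_kit.py`.
-/
/-
Copyright: pub-hodgecm formalisation cell (harness21, 2026). New file (not vendored).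
-/
import Summits.HodgeConjecture.CorCM.Proofs.Prop22.Basic

/-!
# rfwf Prop 2.2, Steps A–D: the corner/period-type dictionary

From the data of the surface criterion — morphisms `Fᵢ : S → A_{Ψᵢ}` and holomorphic `ι₁`-eigen one-forms
`αᵢ` on the four PERIOD types `Ψ = f.psi` — we build a morphism `fP : S → P(f) = ∏ A_{Φᵢ}` to the product
of the four CORNER types `Φ = f.corner` and four `ι₁`-eigenclasses `cᵢ ∈ H¹(A_{Φᵢ}, ℂ)_{ι₁}` such that
`fP^*(pr₀^*c₀ ∪ pr₁^*c₁ ∪ pr₂^*c₂ ∪ pr₃^*c₃)` has trace on `S` equal to the period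
`∫_S F₀^*α₀ ∧ F₁^*α₁ ∧ \overline{F₂^*α₂ ∧ F₃^*α₃}`.

The dictionary (rfwf Def 1.1 vs. PerL Thm 4.4; the typing risk B.4(3) of the follow-ups note) is:
`Φ₀ = Ψ₀`, `Φ₃ = Ψ₁` (definitionally) and `Φ₁ = Ψ̄₂`, `Φ₂ = Ψ̄₃` (`corner_one_iff`, `corner_two_iff`);
at the conjugate corners one composes `F₂, F₃` with the `F`-antilinear isogenies `A_{Ψ₂} → A_{Φ₁}`,
`A_{Ψ₃} → A_{Φ₂}` of M25 and takes `c₁ = conj (u₁^*)⁻¹ α₂`, `c₂ = conj (u₂^*)⁻¹ α₃`, which are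
`ι₁`-eigen because conjugation and antilinearity cancel. Facts used: M2, M3, M18, M19, M20, M25.
No placeholders.
-/

noncomputable section

open scoped TensorProduct

namespace Summit.HodgeConjecture.CorCM

open Literature.AlgebraicGeometry.Motives
open Literature.AlgebraicGeometry.Motives.HodgeStructure (EndAction conj ofRat conj_baseChange conj_smul
  conj_conj conj_tmul)
open Literature.NumberTheory.Automorphic (cmConjRingHom embedding_cmConjRingHom)
open NumberField.ComplexEmbedding (conjugate)
open Literature.NumberTheory.ComplexMultiplication.CMTypeOps

namespace Face

variable {K : Type} [Field K]

/-- Corner/period-type dictionary: `Φ₁ = Ψ₁` (`corner 0 = psi 0`). -/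
theorem corner_zero (f : Face K) : f.corner 0 = f.psi 0 := rfl

/-- Corner/period-type dictionary: `Φ₄ = Ψ₂` (`corner 3 = psi 1`). -/
theorem corner_three (f : Face K) : f.corner 3 = f.psi 1 := rfl

/-- `Φ₁ = Ψ̄₂`: `φ ∈ Φ^{(π)}‾` iff `φ̄ ∈ Φ^{(π)}` — here with `Φ₁ = (Φ̄)^{(π)}` as in rfwf Def 1.1. -/
theorem corner_one_iff (f : Face K) (φ : K →+* ℂ) : φ ∈ (f.corner 1).1 ↔ conjugate φ ∈ (f.psi 2).1 := by
  show φ ∈ (flip f.p (bar f.Φ)).1 ↔ conjugate φ ∈ (flip f.p f.Φ).1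
  rw [mem_flip_iff, mem_flip_iff, mem_bar_iff, conjugate_mem_placeSet_iff, conjugate_mem_iff_notMem]

/-- `Φ₂ = Ψ̄₃`. -/
theorem corner_two_iff (f : Face K) (φ : K →+* ℂ) : φ ∈ (f.corner 2).1 ↔ conjugate φ ∈ (f.psi 3).1 := by
  show φ ∈ (flip f.p' (bar f.Φ)).1 ↔ conjugate φ ∈ (flip f.p' f.Φ).1
  rw [mem_flip_iff, mem_flip_iff, mem_bar_iff, conjugate_mem_placeSet_iff, conjugate_mem_iff_notMem]

end Face

namespace Universe

variable {U : Universe}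

/-- Transport of an `ι₁`-eigenclass through an `F`-antilinear isogeny followed by complex conjugation
(Step C): if `u^*` is injective with `u^* ∘ ι'(e)^* = ι(ē)^* ∘ u^*` and `u^* a = x` with `x` an
`ι₁`-eigenvector for `ι`, then `conj a` is an `ι₁`-eigenvector for `ι'`. -/
theorem conj_transport_mem_eigenLine {K : CMField} {Φ Φ' : CMType K} (u : U.Mor (U.cmAV K Φ) (U.cmAV K Φ'))
    (hinj : Function.Injective (U.pullC u 1))
    (hu : ∀ a : K, U.pull u 1 ∘ₗ (U.cmAct K Φ').ι a = (U.cmAct K Φ).ι (cmConjRingHom K a) ∘ₗ U.pull u 1)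
    {ι₁ : K →+* ℂ} {a : U.CohC (U.cmAV K Φ') 1} (hx : U.pullC u 1 a ∈ U.eigenLine K Φ ι₁) :
    conj a ∈ U.eigenLine K Φ' ι₁ := by
  rw [mem_eigenLine_iff] at hx ⊢
  intro e
  have key : ((U.cmAct K Φ').ι e).baseChange ℂ a = ι₁ (cmConjRingHom K e) • a := by
    apply hinj
    have h1 := baseChange_baseChange_of_comp_eq (hu e) a
    rw [map_smul]
    change U.pullC u 1 (((U.cmAct K Φ').ι e).baseChange ℂ a) = _
    rw [show U.pullC u 1 (((U.cmAct K Φ').ι e).baseChange ℂ a)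
        = ((U.cmAct K Φ).ι (cmConjRingHom K e)).baseChange ℂ (U.pullC u 1 a) from by
          rw [Universe.pullC, h1, LinearMap.baseChange_comp]; rfl]
    exact hx _
  rw [← conj_baseChange, key, conj_smul, embedding_cmConjRingHom, starRingEnd_self_apply]

/-- **Steps A–D of rfwf Prop 2.2.** For the surface-criterion data there are a morphism
`fP : S → P(f)` and `ι₁`-eigenclasses `cᵢ ∈ H¹(A_{Φᵢ}, ℂ)_{ι₁}` on the four corners with
`∫_S fP^*(pr₀^*c₀ ∪ pr₁^*c₁ ∪ pr₂^*c₂ ∪ pr₃^*c₃) = ∫_S F₀^*α₀ ∧ F₁^*α₁ ∧ \overline{F₂^*α₂ ∧ F₃^*α₃}`. -/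
theorem exists_weilGen_pullback (M : U.ModelAxioms) (F : CMField) (f : Face F) (ι₁ : F →+* ℂ)
    (S : U.Var) (Fm : (i : Fin 4) → U.Mor S (U.cmAV F (f.psi i)))
    (α : (i : Fin 4) → U.CohC (U.cmAV F (f.psi i)) 1) (hα : ∀ i, α i ∈ U.alphaLine F (f.psi i) ι₁) :
    ∃ (fP : U.Mor S (U.prod4 F f.corner)) (c : (i : Fin 4) → U.CohC (U.cmAV F (f.corner i)) 1),
      (∀ i, c i ∈ U.eigenLine F (f.corner i) ι₁) ∧
      U.trC S 4 (U.pullC fP 4 (U.weilGen F f.corner c)) = U.period S (fun i => U.pullC (Fm i) 1 (α i)) := by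
  -- Step A: antilinear isogenies at the two conjugate corners
  obtain ⟨u₁, hu₁b, hu₁a⟩ := M.conjIsogeny F (f.psi 2) (f.corner 1) (f.corner_one_iff)
  obtain ⟨u₂, hu₂b, hu₂a⟩ := M.conjIsogeny F (f.psi 3) (f.corner 2) (f.corner_two_iff)
  obtain ⟨inv₁, hinv₁, hinv₁'⟩ := baseChange_inverse (U.pull u₁ 1) hu₁b
  obtain ⟨inv₂, hinv₂, hinv₂'⟩ := baseChange_inverse (U.pull u₂ 1) hu₂b
  have hinj₁ : Function.Injective (U.pullC u₁ 1) :=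
    Function.LeftInverse.injective (g := inv₁) hinv₁'
  have hinj₂ : Function.Injective (U.pullC u₂ 1) :=
    Function.LeftInverse.injective (g := inv₂) hinv₂'
  -- Step B: the morphism to the corner product
  let g₀ : U.Mor S (U.cmAV F (f.corner 0)) := Fm 0
  let g₁ : U.Mor S (U.cmAV F (f.corner 1)) := U.comp (Fm 2) u₁
  let g₂ : U.Mor S (U.cmAV F (f.corner 2)) := U.comp (Fm 3) u₂
  let g₃ : U.Mor S (U.cmAV F (f.corner 3)) := Fm 1
  obtain ⟨h01, h01f, h01s⟩ := M.lift _ _ _ g₀ g₁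
  obtain ⟨h012, h012f, h012s⟩ := M.lift _ _ _ h01 g₂
  obtain ⟨fP, hfPf, hfPs⟩ : ∃ h : U.Mor S (U.prod4 F f.corner),
      U.comp h (U.fst _ _) = h012 ∧ U.comp h (U.snd _ _) = g₃ := M.lift _ _ _ h012 g₃
  have c1 : ∀ y, U.pull fP 1 (U.pull (U.fst _ _) 1 y) = U.pull h012 1 y := fun y => by
    show (U.pull fP 1 ∘ₗ U.pull (U.fst _ _) 1) y = _; rw [← M.pull_comp, hfPf]
  have c1' : ∀ y, U.pull fP 1 (U.pull (U.snd _ _) 1 y) = U.pull g₃ 1 y := fun y => by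
    show (U.pull fP 1 ∘ₗ U.pull (U.snd _ _) 1) y = _; rw [← M.pull_comp, hfPs]
  have c2 : ∀ y, U.pull h012 1 (U.pull (U.fst _ _) 1 y) = U.pull h01 1 y := fun y => by
    show (U.pull h012 1 ∘ₗ U.pull (U.fst _ _) 1) y = _; rw [← M.pull_comp, h012f]
  have c2' : ∀ y, U.pull h012 1 (U.pull (U.snd _ _) 1 y) = U.pull g₂ 1 y := fun y => by
    show (U.pull h012 1 ∘ₗ U.pull (U.snd _ _) 1) y = _; rw [← M.pull_comp, h012s]
  have c3 : ∀ y, U.pull h01 1 (U.pull (U.fst _ _) 1 y) = U.pull g₀ 1 y := fun y => by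
    show (U.pull h01 1 ∘ₗ U.pull (U.fst _ _) 1) y = _; rw [← M.pull_comp, h01f]
  have c3' : ∀ y, U.pull h01 1 (U.pull (U.snd _ _) 1 y) = U.pull g₁ 1 y := fun y => by
    show (U.pull h01 1 ∘ₗ U.pull (U.snd _ _) 1) y = _; rw [← M.pull_comp, h01s]
  have e0 : U.pull fP 1 ∘ₗ U.pull (U.pr4 F f.corner 0) 1 = U.pull g₀ 1 := by
    ext y
    show U.pull fP 1 (U.pull (U.comp (U.fst _ _) (U.comp (U.fst _ _) (U.fst _ _))) 1 y) = _
    rw [M.pull_comp, LinearMap.comp_apply, M.pull_comp, LinearMap.comp_apply, c1, c2, c3]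
  have e1 : U.pull fP 1 ∘ₗ U.pull (U.pr4 F f.corner 1) 1 = U.pull g₁ 1 := by
    ext y
    show U.pull fP 1 (U.pull (U.comp (U.fst _ _) (U.comp (U.fst _ _) (U.snd _ _))) 1 y) = _
    rw [M.pull_comp, LinearMap.comp_apply, M.pull_comp, LinearMap.comp_apply, c1, c2, c3']
  have e2 : U.pull fP 1 ∘ₗ U.pull (U.pr4 F f.corner 2) 1 = U.pull g₂ 1 := by
    ext y
    show U.pull fP 1 (U.pull (U.comp (U.fst _ _) (U.snd _ _)) 1 y) = _
    rw [M.pull_comp, LinearMap.comp_apply, c1, c2']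
  have e3 : U.pull fP 1 ∘ₗ U.pull (U.pr4 F f.corner 3) 1 = U.pull g₃ 1 := by
    ext y
    exact c1' y
  -- Step C: the four eigenclasses
  let a₁ := inv₁ (α 2)
  let a₂ := inv₂ (α 3)
  have ha₁ : U.pullC u₁ 1 a₁ = α 2 := hinv₁ _
  have ha₂ : U.pullC u₂ 1 a₂ = α 3 := hinv₂ _
  have hc₁ : conj a₁ ∈ U.eigenLine F (f.corner 1) ι₁ :=
    conj_transport_mem_eigenLine u₁ hinj₁ hu₁a (by rw [ha₁]; exact alphaLine_le_eigenLine _ _ _ (hα 2))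
  have hc₂ : conj a₂ ∈ U.eigenLine F (f.corner 2) ι₁ :=
    conj_transport_mem_eigenLine u₂ hinj₂ hu₂a (by rw [ha₂]; exact alphaLine_le_eigenLine _ _ _ (hα 3))
  let c : (i : Fin 4) → U.CohC (U.cmAV F (f.corner i)) 1 := fun i =>
    match i with
    | 0 => α 0
    | 1 => conj a₁
    | 2 => conj a₂
    | 3 => α 1
  refine ⟨fP, c, ?_, ?_⟩
  · intro i
    match i with
    | 0 => exact alphaLine_le_eigenLine _ _ _ (hα 0)
    | 1 => exact hc₁
    | 2 => exact hc₂
    | 3 => exact alphaLine_le_eigenLine _ _ _ (hα 1)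
  -- Step D: pull back and rearrange
  · have hy : U.pullC fP 4 (U.weilGen F f.corner c) = U.quadC S (U.pullC (Fm 0) 1 (α 0))
        (conj (U.pullC (Fm 2) 1 (α 2))) (conj (U.pullC (Fm 3) 1 (α 3))) (U.pullC (Fm 1) 1 (α 1)) := by
      rw [Universe.weilGen, pullC_quadC M.pull_cup, pullC_pullC_of_comp_eq e0, pullC_pullC_of_comp_eq e1,
        pullC_pullC_of_comp_eq e2, pullC_pullC_of_comp_eq e3]
      show U.quadC S (U.pullC (Fm 0) 1 (α 0)) (U.pullC (U.comp (Fm 2) u₁) 1 (conj a₁))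
        (U.pullC (U.comp (Fm 3) u₂) 1 (conj a₂)) (U.pullC (Fm 1) 1 (α 1)) = _
      rw [pullC_comp_apply M.pull_comp, pullC_comp_apply M.pull_comp, ← conj_pullC u₁, ← conj_pullC u₂,
        ha₁, ha₂, ← conj_pullC, ← conj_pullC]
    rw [hy, quadC_acdb M.cup_comm1 M.cup_interchange]
    rfl

end Universe

end Summit.HodgeConjecture.CorCM

end
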